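import Summits.KontsevichZagierPeriods.KontsevichZagierPeriods.Theorems.SoloBlindEllipticCells
import Literature.NumberTheory.Transcendental.KZCalculusProofs
import HarnessLib

/-!
# Landen's transformation inside the rules

For a real algebraic modulus `k ∈ (0,1)` put `k₁ = 2√k/(1+k)`, i.e. `k₁² = λ(k) = 4k/(1+k)²`.
**Gauss's substitution** `t₁ = φ_k(t) = (1+k)t/(1+kt²)` is a rational bijection of `(0,1)` with
the algebraic coefficient `k`, and

  `1 - φ² = (1-t²)(1-k²t²)/(1+kt²)²`,  `1 - λφ² = (1-kt²)²/(1+kt²)²`,  `φ' = (1+k)(1-kt²)/(1+kt²)²`,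

so `f_λ(φ(t)) φ'(t) = (1+k) f_{k²}(t)` with the `K`-integrands `f_μ` of
`SoloBlindEllipticCells`.  Hence **Landen's (ascending) transformation is ONE move** (rule (2)):

  `[K_λ] = (1+k)·[K_{k²}]` in `Q`   (`mkQ_ellK_landen`),   `K(2√k/(1+k)) = (1+k) K(k)`   (`landen`),

the modular equation of degree `2` for the complete elliptic integral of the first kind, for
every real algebraic `k ∈ (0,1)`, decided inside the three rules.
-/

noncomputable section

namespace Summit.KontsevichZagierPeriods.KontsevichZagierPeriods.Theorems

open Set MeasureTheory
open Literature.ModelTheory.ExponentialFields (IsSemialgebraic)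
open Literature.NumberTheory.Transcendental
open Literature.NumberTheory.Transcendental.KZ

namespace SoloBlind

/-! ## Gauss's substitution -/

/-- The Landen modulus-square `λ(k) = 4k/(1+k)²` (`= k₁²`, `k₁ = 2√k/(1+k)`). -/
def landenMod (k : ℝ) : ℝ := 4 * k / (1 + k) ^ 2

/-- Gauss's substitution `φ_k(t) = (1+k)t/(1+kt²)`. -/
def gaussMap (k t : ℝ) : ℝ := (1 + k) * t / (1 + k * t ^ 2)

/-- Its derivative `φ_k'(t) = (1+k)(1-kt²)/(1+kt²)²`. -/
def gaussMapDeriv (k t : ℝ) : ℝ := (1 + k) * (1 - k * t ^ 2) / (1 + k * t ^ 2) ^ 2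

variable {k t : ℝ}

/-- `λ(k) ∈ (0,1)` for `k ∈ (0,1)`. -/
theorem landenMod_mem (hk : k ∈ Ioo (0:ℝ) 1) : landenMod k ∈ Ioo (0:ℝ) 1 := by
  have h1 : 0 < (1 + k) ^ 2 := by nlinarith [hk.1]
  refine ⟨div_pos (by linarith [hk.1]) h1, (div_lt_one h1).mpr ?_⟩
  nlinarith [hk.2, sq_nonneg (1 - k)]

/-- `λ(k)` is algebraic for algebraic `k`. -/
theorem isAlgebraic_landenMod (hk : IsAlgebraic ℚ k) : IsAlgebraic ℚ (landenMod k) := by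
  rw [landenMod, div_eq_mul_inv]
  exact ((isAlgebraic_nat 4).mul hk).mul ((isAlgebraic_one.add hk).pow 2).inv

/-- Basic signs on `(0,1)`: `0 < 1 + kt²`, `0 < 1 - kt²`, `0 < 1 - t²`, `0 < 1 - k²t²`. -/
theorem landen_aux (hk : k ∈ Ioo (0:ℝ) 1) (ht : t ∈ Ioo (0:ℝ) 1) :
    0 < 1 + k * t ^ 2 ∧ 0 < 1 - k * t ^ 2 ∧ 0 < 1 - t ^ 2 ∧ 0 < 1 - k ^ 2 * t ^ 2 := by
  have ht2 : t ^ 2 < 1 := by nlinarith [ht.1, ht.2]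
  have hk2 : k ^ 2 < 1 := by nlinarith [hk.1, hk.2]
  refine ⟨by nlinarith [hk.1, sq_nonneg t], by nlinarith [hk.2, sq_nonneg t, hk.1], by linarith,
    by nlinarith [sq_nonneg t, sq_nonneg k]⟩

/-- `φ_k` maps `(0,1)` into `(0,1)`. -/
theorem gaussMap_mem (hk : k ∈ Ioo (0:ℝ) 1) (ht : t ∈ Ioo (0:ℝ) 1) :
    gaussMap k t ∈ Ioo (0:ℝ) 1 := by
  obtain ⟨hD, -, -, -⟩ := landen_aux hk ht
  refine ⟨div_pos (by nlinarith [hk.1, ht.1]) hD, (div_lt_one hD).mpr ?_⟩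
  nlinarith [mul_pos (sub_pos.mpr ht.2) (show 0 < 1 - k * t by nlinarith [hk.2, ht.2, hk.1, ht.1])]

/-- `φ_k` is injective on `(0,1)`. -/
theorem injOn_gaussMap (hk : k ∈ Ioo (0:ℝ) 1) : InjOn (gaussMap k) (Ioo (0:ℝ) 1) := by
  intro s hs t ht h
  obtain ⟨hDs, -⟩ := landen_aux hk hs
  obtain ⟨hDt, -⟩ := landen_aux hk ht
  unfold gaussMap at h
  rw [div_eq_div_iff hDs.ne' hDt.ne'] at h
  have h1 : (s - t) * ((1 + k) * (1 - k * s * t)) = 0 := by nlinarith [h]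
  have h2 : 0 < (1 + k) * (1 - k * s * t) := by
    have hst : s * t < 1 := by nlinarith [hs.1, hs.2, ht.1, ht.2]
    have : k * s * t < 1 := by
      nlinarith [mul_pos (mul_pos hs.1 ht.1) (sub_pos.mpr hk.2), hst]
    nlinarith [hk.1]
  rcases mul_eq_zero.mp h1 with h3 | h3
  · linarith
  · exact absurd h3 h2.ne'

/-- `φ_k` is differentiable with derivative `φ_k'`. -/
theorem hasDerivAt_gaussMap (hk : k ∈ Ioo (0:ℝ) 1) (ht : t ∈ Ioo (0:ℝ) 1) :
    HasDerivAt (gaussMap k) (gaussMapDeriv k t) t := by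
  obtain ⟨hD, -⟩ := landen_aux hk ht
  have h1 := (hasDerivAt_id' t).const_mul (1 + k)
  have h2 := (((hasDerivAt_id' t).pow 2).const_mul k).const_add 1
  have h := h1.div h2 hD.ne'
  refine (h.congr_of_eventuallyEq (Filter.Eventually.of_forall fun s => rfl)).congr_deriv ?_
  rw [gaussMapDeriv]
  norm_num
  field_simp
  ring

/-- `φ_k` is continuous on `[0,1]`. -/
theorem continuousOn_gaussMap (hk : k ∈ Ioo (0:ℝ) 1) :
    ContinuousOn (gaussMap k) (Icc (0:ℝ) 1) := by
  unfold gaussMap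
  refine ContinuousOn.div (by fun_prop) (by fun_prop) fun s hs => ?_
  nlinarith [hk.1, sq_nonneg s]

/-- `φ_k '' (0,1) = (0,1)`. -/
theorem image_gaussMap (hk : k ∈ Ioo (0:ℝ) 1) : Ioo (0:ℝ) 1 = gaussMap k '' Ioo 0 1 := by
  refine Subset.antisymm ?_ (image_subset_iff.mpr fun t ht => gaussMap_mem hk ht)
  have h := intermediate_value_Ioo zero_le_one (continuousOn_gaussMap hk)
  have h0 : gaussMap k 0 = 0 := by simp [gaussMap]
  have h1 : gaussMap k 1 = 1 := by
    have h : (1:ℝ) + k ≠ 0 := by linarith [hk.1]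
    rw [gaussMap, one_pow, mul_one, mul_one, div_self h]
  rwa [h0, h1] at h

/-- `φ_k` is `ℚ`-semialgebraic on the line `(0,1)` (`k` algebraic). -/
theorem isSemialgebraicFunOn_gaussMap (hka : IsAlgebraic ℚ k) :
    IsSemialgebraicFunOn ℚ (line (Ioo (0:ℝ) 1)) fun x => gaussMap k (x 0) := by
  have hW : IsSemialgebraic ℚ (line (Ioo (0:ℝ) 1)) :=
    isSemialgebraic_line_Ioo isAlgebraic_zero isAlgebraic_one
  have ha := isSemialgebraicFunOn_apply hW 0
  have h1 := isSemialgebraicFunOn_const_of_isAlgebraic hW isAlgebraic_one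
  have hc := isSemialgebraicFunOn_const_of_isAlgebraic hW hka
  exact (((h1.fun_add hc).fun_mul ha).fun_mul
    ((h1.fun_add (hc.fun_mul (ha.fun_pow 2))).fun_inv)).congr
    fun x _ => by simp only [gaussMap, div_eq_mul_inv]

/-- **The pullback identity** `f_λ(φ(t)) |φ'(t)| = (1+k) f_{k²}(t)` on `(0,1)`. -/
theorem landen_pullback (hk : k ∈ Ioo (0:ℝ) 1) (ht : t ∈ Ioo (0:ℝ) 1) :
    (1 + k) * ellKf (k ^ 2) t = ellKf (landenMod k) (gaussMap k t) * |gaussMapDeriv k t| := by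
  obtain ⟨hD, hE, hP, hQ⟩ := landen_aux hk ht
  have hφ' : 0 < gaussMapDeriv k t := by
    unfold gaussMapDeriv; exact div_pos (by nlinarith [hk.1]) (by positivity)
  have key : (1 - gaussMap k t ^ 2) * (1 - landenMod k * gaussMap k t ^ 2) =
      (1 - t ^ 2) * (1 - k ^ 2 * t ^ 2) * ((1 - k * t ^ 2) / (1 + k * t ^ 2) ^ 2) ^ 2 := by
    have h1 : 1 + k ≠ 0 := by linarith [hk.1]
    rw [gaussMap, landenMod]
    field_simp
    ring
  rw [abs_of_pos hφ', ellKf, ellKf, key, Real.sqrt_mul (mul_pos hP hQ).le,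
    Real.sqrt_sq (by positivity), gaussMapDeriv]
  have hs : 0 < Real.sqrt ((1 - t ^ 2) * (1 - k ^ 2 * t ^ 2)) := Real.sqrt_pos.mpr (mul_pos hP hQ)
  field_simp

/-! ## The move -/

section

variable (k : ℝ) (hka : IsAlgebraic ℚ k) (hk : k ∈ Ioo (0:ℝ) 1)

/-- `k² ∈ (0,1)`. -/
theorem sq_mem_Ioo (hk : k ∈ Ioo (0:ℝ) 1) : k ^ 2 ∈ Ioo (0:ℝ) 1 :=
  ⟨by nlinarith [hk.1], by nlinarith [hk.1, hk.2]⟩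

/-- The scaled source `[(0,1), (1+k) f_{k²}]`. -/
def landenSrc : IntegralRep 1 :=
  lineRep (Ioo 0 1) (fun t => (1 + k) * ellKf (k ^ 2) t)
    (isSemialgebraic_line_Ioo isAlgebraic_zero isAlgebraic_one)
    ((isSemialgebraicFunOn_const_of_isAlgebraic
        (isSemialgebraic_line_Ioo isAlgebraic_zero isAlgebraic_one)
        (isAlgebraic_one.add hka)).fun_mul
      (isSemialgebraicFunOn_ellKf (isSemialgebraicFunOn_apply
        (isSemialgebraic_line_Ioo isAlgebraic_zero isAlgebraic_one) 0) (hka.pow 2)))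
    ((integrableOn_ellKf (Ioo_subset_Ico_self (sq_mem_Ioo k hk))).const_mul (1 + k))

/-- **Gauss's substitution is a move** (rule (2)): `[(0,1), (1+k) f_{k²}] - K_λ ∈ relations`. -/
theorem landenSrc_sub_ellK :
    of (landenSrc k hka hk) -
      of (ellK (landenMod k) (isAlgebraic_landenMod hka) (landenMod_mem hk)) ∈ relations := by
  unfold landenSrc ellK
  exact lineRep_subst (gaussMap k) (gaussMapDeriv k) (isSemialgebraicFunOn_gaussMap hka)
    (fun t ht => (hasDerivAt_gaussMap hk ht).hasDerivWithinAt) (injOn_gaussMap hk)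
    (image_gaussMap hk) (fun t ht => landen_pullback hk ht)

/-- Scaling (rules (1)+(2) via Fubini with a constant cell): `(1+k)·K_{k²} - [(0,1), (1+k) f_{k²}]`
is a relation. -/
theorem constMul_sub_landenSrc :
    of ((ellK (k ^ 2) (hka.pow 2) (sq_mem_Ioo k hk)).constMul (1 + k) (isAlgebraic_one.add hka)) -
      of (landenSrc k hka hk) ∈ relations :=
  of_sub_of_mem_relations_of_eqOn rfl fun x _ => by
    simp [IntegralRep.integrand_constMul, landenSrc, ellK_integrand]

/-- **Landen's transformation inside the rules**: `(1+k)·K_{k²} ~ K_λ`, `λ = 4k/(1+k)²`. -/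
theorem kz_landen :
    Equivalent ((ellK (k ^ 2) (hka.pow 2) (sq_mem_Ioo k hk)).constMul (1 + k)
        (isAlgebraic_one.add hka))
      (ellK (landenMod k) (isAlgebraic_landenMod hka) (landenMod_mem hk)) := by
  have h := relations.add_mem (constMul_sub_landenSrc k hka hk) (landenSrc_sub_ellK k hka hk)
  rwa [sub_add_sub_cancel] at h

/-- **`[K_λ] = (1+k)·[K_{k²}]` in `Q`.** -/
theorem mkQ_ellK_landen :
    mkQ (of (ellK (landenMod k) (isAlgebraic_landenMod hka) (landenMod_mem hk))) =
      (⟨1 + k, mem_K₀_iff.mpr (isAlgebraic_one.add hka)⟩ : K₀) •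
        mkQ (of (ellK (k ^ 2) (hka.pow 2) (sq_mem_Ioo k hk))) := by
  rw [← mkQ_constMul, eq_comm, mkQ_eq_mkQ_iff]
  exact kz_landen k hka hk

/-- **The conjecture for Landen's transformation.** The volume-under-the-graph representations
of `(1+k)·K_{k²}` and of `K_λ` (dimension `2`, both `ℚ`-rational: two rational representations of
the period `K(2√k/(1+k))` in the literal sense of the Statement) are KZ-equivalent, for every real
algebraic `k ∈ (0,1)`. -/
theorem kz_landen_graph :
    (((ellK (k ^ 2) (hka.pow 2) (sq_mem_Ioo k hk)).constMul (1 + k)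
        (isAlgebraic_one.add hka)).graphRep
        Literature.ModelTheory.ExponentialFields.tarski_seidenberg_real_holds).IsRational ∧
      ((ellK (landenMod k) (isAlgebraic_landenMod hka) (landenMod_mem hk)).graphRep
        Literature.ModelTheory.ExponentialFields.tarski_seidenberg_real_holds).IsRational ∧
      Equivalent
        (((ellK (k ^ 2) (hka.pow 2) (sq_mem_Ioo k hk)).constMul (1 + k)
          (isAlgebraic_one.add hka)).graphRep
          Literature.ModelTheory.ExponentialFields.tarski_seidenberg_real_holds)
        ((ellK (landenMod k) (isAlgebraic_landenMod hka) (landenMod_mem hk)).graphRep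
          Literature.ModelTheory.ExponentialFields.tarski_seidenberg_real_holds) :=
  ⟨IntegralRep.isRational_graphRep _ _, IntegralRep.isRational_graphRep _ _,
    ((IntegralRep.equivalent_graphRep _ _).symm.trans (kz_landen k hka hk)).trans
      (IntegralRep.equivalent_graphRep _ _)⟩

/-- **Landen's transformation** `K(2√k/(1+k)) = (1+k) K(k)`:
`∫₀¹ dt/√((1-t²)(1-λt²)) = (1+k) ∫₀¹ dt/√((1-t²)(1-k²t²))`, `λ = 4k/(1+k)²`, for every real
algebraic `k ∈ (0,1)`. -/
theorem landen (hka : IsAlgebraic ℚ k) (hk : k ∈ Ioo (0:ℝ) 1) :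
    ∫ t in Ioo (0:ℝ) 1, ellKf (landenMod k) t = (1 + k) * ∫ t in Ioo (0:ℝ) 1, ellKf (k ^ 2) t := by
  have h := congrArg evalQ (mkQ_ellK_landen k hka hk)
  rw [evalQ_mkQ, eval_of, evalQ_smul, evalQ_mkQ, eval_of, ellK_value, ellK_value] at h
  exact h

end

end SoloBlind

end Summit.KontsevichZagierPeriods.KontsevichZagierPeriods.Theorems
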